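import Mathlib
import HarnessLib
import Summits.ValiantsHypothesis.ValiantsHypothesis.Theorems.LacunarySymmetroidMatrixDescartesOsculationLawRankOneCurve
import Summits.ValiantsHypothesis.ValiantsHypothesis.Theorems.LacunarySymmetroidMatrixDescartesOsculationLawStubRankOne
import Summits.ValiantsHypothesis.ValiantsHypothesis.Theorems.LacunarySymmetroidMatrixDescartesOsculationLawPeelRankOneArc

/-!
# ValiantsHypothesis / LacunarySymmetroid — crux `MatrixDescartes` (stmt-ValiantsHypothesis-18050, V1),
# line `Cruxes/MatrixDescartes/Lines/osculation_law.lean` («osculation-law»): the rank-one peel, CURVE FORM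

The line's theorem-shaped stub is `stub_peel : PeelInequality` — for every block splitting `r + s`, inserting
one semidefinite letter `c·t^N·(I_r ⊕ 0)` into a symmetric block pencil `G` costs, in positive zeros counted with
multiplicity, at most `2·ι(G, I_r ⊕ 0) + 2r + 2·Z₊mult(det G) + 3·Z₊mult(det G₂₂)` (general position assumed:
`det G ≢ 0`, `det G₂₂ ≢ 0`, finitely many osculation points, each smooth and off the line `b = c·t^N`).

This file proves the CURVE FORM `OsculationPeel.peel_curve` of the `r = 1` instance: for `Φ = ι f + X₁·ι a`
(arbitrary `f a : ℝ[X]`, `ι : X ↦ X₀`) with finite osculation set all of whose points are off the arc `b = c·t^N`,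
`Z₊mult(f + c·X^N·a) ≤ 2·#osc + 2·1 + 2·Z₊mult(f) + 3·Z₊mult(a)`; the pencil-level statement
(`peelInequality_rankOne` = `PeelInequality` with `r := 1` verbatim) is `…OsculationLawPeelRankOne`.

Proof («a line meets an inflection-free arc at most twice», multiplicity currency).  At `r = 1`,
`det(G + c t^N (I₁ ⊕ 0)) = f + c·X^N·a` (`f = det G`, `a = det G₂₂`; `det_add_smul_blockProj`).  Finiteness of the
osculation set forbids a common positive zero of `f` and `a` (a vertical ray of osculation points), so every
positive root `t₀` of `g = f + cX^N a` has `a(t₀) ≠ 0`, `f(t₀) ≠ 0`, `f·a < 0`; and `R(t₀) ≠ 0`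
(`R = W(f)a² − W(a)f²`), for otherwise `(t₀, −f/a(t₀)) = (t₀, c t₀^N)` would be an osculation point ON the line,
excluded by the stub's hypothesis.  CUT the half-line at the positive zeros of `f`, of `a`, and at the osculation
abscissae `{t > 0 : f·a < 0, R(t) = 0}` (at most `ι` of them: `t ↦ (t, −f/a)` injects them into the osculation
set); two roots of `g` with the same number of cuts below them lie on a common open arc free of zeros of `f`, `a`,
`R` (sign of `f·a` constant by the intermediate value theorem), and the ARC LEMMA
(`…OsculationLawPeelRankOneArc`) allows at most two roots with multiplicity per arc; pigeonhole over the at most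
`Z₊(f) + Z₊(a) + ι + 1` arcs gives `Z₊mult(g) ≤ 2ι + 2 + 2Z₊mult(f) + 2Z₊mult(a)`, within the stub's budget.

Honest framing: the `r = 1` INSTANCE only — `stub_peel` for all ranks (Rellich-type eigenvalue branches), the LAW
`stub_osculationLaw`, `stub_recursion`, `MatrixDescartes`, Conjecture B and `VP ≠ VNP` stay OPEN / NOT proved, and
nothing here is progress on them; the symmetry and the two `≢ 0` hypotheses of the stub are idle at rank one.  No
definitions, no named facts; Mathlib only.
-/

-- `Summit.ValiantsHypothesis.ValiantsHypothesis.…` is the tree's mandated single-conjunct layout (Sub = Summit).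
set_option linter.dupNamespace false

noncomputable section

namespace Summit.ValiantsHypothesis.ValiantsHypothesis.Theorems.LacunarySymmetroidMatrixDescartes

open Polynomial Set
open scoped BigOperators

namespace OsculationPeel

/-! ### The rank-one peel for an affine curve `Φ = ι f + X₁·ι a` -/

/-- **Rank-one peel, curve form.**  For `Φ = ι f + X₁·ι a` with finite osculation set all of whose points are
off the monomial arc `b = c·t^N`, the positive roots of `g = f + c·X^N·a` counted with multiplicity number at most
`2·#osc + 2 + 2·Z₊mult(f) + 3·Z₊mult(a)`. -/
theorem peel_curve (f a : ℝ[X]) (c : ℝ) (N : ℕ) (hc : 0 < c) (Φ : MvPolynomial (Fin 2) ℝ)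
    (hΦ : Φ = Polynomial.aeval (MvPolynomial.X 0 : MvPolynomial (Fin 2) ℝ) f
        + MvPolynomial.X 1 * Polynomial.aeval (MvPolynomial.X 0 : MvPolynomial (Fin 2) ℝ) a)
    (hfin : {p : Fin 2 → ℝ | 0 < p 0 ∧ 0 < p 1 ∧ MvPolynomial.eval p Φ = 0 ∧
      MvPolynomial.eval p
        (MvPolynomial.X 0 * MvPolynomial.pderiv 0 (MvPolynomial.X 0 * MvPolynomial.pderiv 0 Φ)
            * (MvPolynomial.X 1 * MvPolynomial.pderiv 1 Φ) ^ 2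
          - 2 * (MvPolynomial.X 0 * MvPolynomial.pderiv 0 (MvPolynomial.X 1 * MvPolynomial.pderiv 1 Φ))
            * (MvPolynomial.X 0 * MvPolynomial.pderiv 0 Φ) * (MvPolynomial.X 1 * MvPolynomial.pderiv 1 Φ)
          + MvPolynomial.X 1 * MvPolynomial.pderiv 1 (MvPolynomial.X 1 * MvPolynomial.pderiv 1 Φ)
            * (MvPolynomial.X 0 * MvPolynomial.pderiv 0 Φ) ^ 2) = 0}.Finite)
    (hgp : ∀ p ∈ {p : Fin 2 → ℝ | 0 < p 0 ∧ 0 < p 1 ∧ MvPolynomial.eval p Φ = 0 ∧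
      MvPolynomial.eval p
        (MvPolynomial.X 0 * MvPolynomial.pderiv 0 (MvPolynomial.X 0 * MvPolynomial.pderiv 0 Φ)
            * (MvPolynomial.X 1 * MvPolynomial.pderiv 1 Φ) ^ 2
          - 2 * (MvPolynomial.X 0 * MvPolynomial.pderiv 0 (MvPolynomial.X 1 * MvPolynomial.pderiv 1 Φ))
            * (MvPolynomial.X 0 * MvPolynomial.pderiv 0 Φ) * (MvPolynomial.X 1 * MvPolynomial.pderiv 1 Φ)
          + MvPolynomial.X 1 * MvPolynomial.pderiv 1 (MvPolynomial.X 1 * MvPolynomial.pderiv 1 Φ)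
            * (MvPolynomial.X 0 * MvPolynomial.pderiv 0 Φ) ^ 2) = 0}, MvPolynomial.eval p (MvPolynomial.pderiv 1 Φ) ≠ 0 ∧ p 1 ≠ c * p 0 ^ N) :
    Multiset.card ((f + C c * X ^ N * a).roots.filter (fun t => 0 < t)) ≤
      2 * {p : Fin 2 → ℝ | 0 < p 0 ∧ 0 < p 1 ∧ MvPolynomial.eval p Φ = 0 ∧
      MvPolynomial.eval p
        (MvPolynomial.X 0 * MvPolynomial.pderiv 0 (MvPolynomial.X 0 * MvPolynomial.pderiv 0 Φ)
            * (MvPolynomial.X 1 * MvPolynomial.pderiv 1 Φ) ^ 2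
          - 2 * (MvPolynomial.X 0 * MvPolynomial.pderiv 0 (MvPolynomial.X 1 * MvPolynomial.pderiv 1 Φ))
            * (MvPolynomial.X 0 * MvPolynomial.pderiv 0 Φ) * (MvPolynomial.X 1 * MvPolynomial.pderiv 1 Φ)
          + MvPolynomial.X 1 * MvPolynomial.pderiv 1 (MvPolynomial.X 1 * MvPolynomial.pderiv 1 Φ)
            * (MvPolynomial.X 0 * MvPolynomial.pderiv 0 Φ) ^ 2) = 0}.ncard + 2 * 1 + 2 * Multiset.card (f.roots.filter (fun t => 0 < t))
        + 3 * Multiset.card (a.roots.filter (fun t => 0 < t)) := by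
  classical
  set R : ℝ[X] := ((f * (X * derivative (X * derivative f)) - (X * derivative f) ^ 2) * a ^ 2
          - (a * (X * derivative (X * derivative a)) - (X * derivative a) ^ 2) * f ^ 2) with hR
  set g : ℝ[X] := f + C c * X ^ N * a with hg
  set osc := {p : Fin 2 → ℝ | 0 < p 0 ∧ 0 < p 1 ∧ MvPolynomial.eval p Φ = 0 ∧
      MvPolynomial.eval p
        (MvPolynomial.X 0 * MvPolynomial.pderiv 0 (MvPolynomial.X 0 * MvPolynomial.pderiv 0 Φ)
            * (MvPolynomial.X 1 * MvPolynomial.pderiv 1 Φ) ^ 2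
          - 2 * (MvPolynomial.X 0 * MvPolynomial.pderiv 0 (MvPolynomial.X 1 * MvPolynomial.pderiv 1 Φ))
            * (MvPolynomial.X 0 * MvPolynomial.pderiv 0 Φ) * (MvPolynomial.X 1 * MvPolynomial.pderiv 1 Φ)
          + MvPolynomial.X 1 * MvPolynomial.pderiv 1 (MvPolynomial.X 1 * MvPolynomial.pderiv 1 Φ)
            * (MvPolynomial.X 0 * MvPolynomial.pderiv 0 Φ) ^ 2) = 0} with hosc
  -- membership in the osculation set, in real numbers
  have mem_osc : ∀ p : Fin 2 → ℝ, p ∈ osc ↔ 0 < p 0 ∧ 0 < p 1 ∧ f.eval (p 0) + p 1 * a.eval (p 0) = 0 ∧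
      p 0 * ((derivative f).eval (p 0) + p 1 * (derivative a).eval (p 0)
              + p 0 * ((derivative (derivative f)).eval (p 0)
                  + p 1 * (derivative (derivative a)).eval (p 0)))
          * (p 1 * a.eval (p 0)) ^ 2
        - 2 * (p 0 * (p 1 * (derivative a).eval (p 0)))
          * (p 0 * ((derivative f).eval (p 0) + p 1 * (derivative a).eval (p 0))) * (p 1 * a.eval (p 0))
        + p 1 * a.eval (p 0) * (p 0 * ((derivative f).eval (p 0) + p 1 * (derivative a).eval (p 0))) ^ 2
          = 0 := by
    intro p
    rw [hosc, Set.mem_setOf_eq, OsculationRankOne.eval_logHessian_Phi f a Φ hΦ p, hΦ, OsculationRankOne.eval_Phi]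
  -- (1) no vertical ray: no common positive zero of `f` and `a`
  have hray : ∀ t : ℝ, 0 < t → a.eval t = 0 → f.eval t = 0 → False := by
    intro t ht ha0 hf0
    apply hfin.not_infinite
    refine Set.infinite_of_injOn_mapsTo (f := fun b : ℝ => (![t, b] : Fin 2 → ℝ)) ?_ ?_ (Set.Ioi_infinite 0)
    · intro b _ b' _ hbb'
      have := congr_fun hbb' 1
      simpa [Matrix.cons_val_one] using this
    · intro b hb'
      rw [Set.mem_Ioi] at hb'
      refine (mem_osc _).2 ⟨?_, ?_, ?_, ?_⟩
      · simpa [Matrix.cons_val_zero] using ht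
      · simpa [Matrix.cons_val_one] using hb'
      · simp only [Matrix.cons_val_zero, Matrix.cons_val_one, ha0, hf0, mul_zero, add_zero]
      · simp only [Matrix.cons_val_zero, Matrix.cons_val_one, ha0, mul_zero, zero_mul, add_zero,
          zero_pow two_ne_zero, sub_zero]
  -- (2) osculation abscissae: `t > 0`, `f·a < 0`, `R(t) = 0` gives the osculation point `(t, -f/a)`
  have hemb : ∀ t : ℝ, 0 < t → f.eval t * a.eval t < 0 → R.IsRoot t →
      (![t, -(f.eval t) / a.eval t] : Fin 2 → ℝ) ∈ osc := by
    intro t ht hprod hRt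
    have hat : a.eval t ≠ 0 := by
      intro h0; rw [h0, mul_zero] at hprod; exact lt_irrefl _ hprod
    have hcurve : f.eval t + -(f.eval t) / a.eval t * a.eval t = 0 := by
      field_simp
      ring
    refine (mem_osc _).2 ⟨?_, ?_, ?_, ?_⟩
    · simpa [Matrix.cons_val_zero] using ht
    · simp only [Matrix.cons_val_one, Matrix.cons_val_zero]
      have h1 : -(f.eval t) / a.eval t = (-(f.eval t * a.eval t)) / (a.eval t * a.eval t) := by
        field_simp
      rw [h1]
      exact div_pos (by linarith) (mul_self_pos.2 hat)
    · simp only [Matrix.cons_val_zero, Matrix.cons_val_one]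
      exact hcurve
    · simp only [Matrix.cons_val_zero, Matrix.cons_val_one]
      have key := OsculationRankOne.hess_identity f a t (-(f.eval t) / a.eval t) hcurve
      rw [IsRoot.def] at hRt
      rw [← hR, hRt, mul_zero] at key
      rcases mul_eq_zero.1 key with h | h
      · exact absurd (pow_eq_zero_iff two_ne_zero |>.1 h) hat
      · exact h
  -- (3) positive roots of `g`: `a ≠ 0`, `f ≠ 0`, `f·a < 0`, `R ≠ 0`
  have hroot : ∀ t : ℝ, 0 < t → g.IsRoot t →
      a.eval t ≠ 0 ∧ f.eval t ≠ 0 ∧ f.eval t * a.eval t < 0 ∧ ¬ R.IsRoot t := by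
    intro t ht hgt
    simp only [hg, IsRoot.def, eval_add, eval_mul, eval_C, eval_pow, eval_X] at hgt
    have hf : f.eval t = -(c * t ^ N * a.eval t) := by linarith
    have htN : 0 < t ^ N := pow_pos ht N
    have hat : a.eval t ≠ 0 := by
      intro h0
      exact hray t ht h0 (by rw [hf, h0, mul_zero, neg_zero])
    have hprod : f.eval t * a.eval t < 0 := by
      rw [hf]
      have h2 : 0 < c * t ^ N * (a.eval t * a.eval t) := mul_pos (mul_pos hc htN) (mul_self_pos.2 hat)
      have h3 : -(c * t ^ N * a.eval t) * a.eval t = -(c * t ^ N * (a.eval t * a.eval t)) := by ring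
      rw [h3]
      exact neg_lt_zero.2 h2
    refine ⟨hat, ?_, hprod, ?_⟩
    · rw [hf]; exact neg_ne_zero.2 (mul_ne_zero (mul_ne_zero hc.ne' htN.ne') hat)
    · intro hRt
      have hmem := hemb t ht hprod hRt
      have h2 := (hgp _ hmem).2
      simp only [Matrix.cons_val_one, Matrix.cons_val_zero] at h2
      apply h2
      rw [div_eq_iff hat, hf]
      ring
  -- trivial case `g = 0`
  by_cases hg0 : g = 0
  · rw [hg0, roots_zero, Multiset.filter_zero, Multiset.card_zero]; exact Nat.zero_le _
  -- the cut set
  set Zf : Finset ℝ := f.roots.toFinset.filter (fun t => 0 < t) with hZf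
  set Za : Finset ℝ := a.roots.toFinset.filter (fun t => 0 < t) with hZa
  set T : Finset ℝ := R.roots.toFinset.filter (fun t => 0 < t ∧ f.eval t * a.eval t < 0) with hT
  set P : Finset ℝ := (Zf ∪ Za) ∪ T with hP
  have hZf_card : Zf.card ≤ Multiset.card (f.roots.filter (fun t => 0 < t)) := by
    rw [hZf, ← Multiset.toFinset_filter]; exact Multiset.toFinset_card_le _
  have hZa_card : Za.card ≤ Multiset.card (a.roots.filter (fun t => 0 < t)) := by
    rw [hZa, ← Multiset.toFinset_filter]; exact Multiset.toFinset_card_le _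
  have hT_card : T.card ≤ osc.ncard := by
    have hmaps : ∀ t ∈ (T : Set ℝ), (fun t : ℝ => (![t, -(f.eval t) / a.eval t] : Fin 2 → ℝ)) t ∈ osc := by
      intro t ht
      rw [Finset.mem_coe, hT, Finset.mem_filter, Multiset.mem_toFinset] at ht
      exact hemb t ht.2.1 ht.2.2 (mem_roots'.1 ht.1).2
    have hinj : Set.InjOn (fun t : ℝ => (![t, -(f.eval t) / a.eval t] : Fin 2 → ℝ)) (T : Set ℝ) := by
      intro t _ t' _ htt'
      have := congr_fun htt' 0
      simpa [Matrix.cons_val_zero] using this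
    have := Set.ncard_le_ncard_of_injOn _ hmaps hinj hfin
    rwa [Set.ncard_coe_finset] at this
  have hP_card : P.card ≤ Multiset.card (f.roots.filter (fun t => 0 < t))
      + Multiset.card (a.roots.filter (fun t => 0 < t)) + osc.ncard := by
    calc P.card ≤ (Zf ∪ Za).card + T.card := Finset.card_union_le _ _
      _ ≤ (Zf.card + Za.card) + T.card := Nat.add_le_add_right (Finset.card_union_le _ _) _
      _ ≤ _ := by omega
  -- positive roots of `g` avoid the cut set
  have havoid : ∀ t : ℝ, 0 < t → g.IsRoot t → t ∉ P := by
    intro t ht hgt hP'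
    obtain ⟨hat, hft, -, hRt⟩ := hroot t ht hgt
    simp only [hP, hZf, hZa, hT, Finset.mem_union, Finset.mem_filter, Multiset.mem_toFinset] at hP'
    rcases hP' with (⟨h, -⟩ | ⟨h, -⟩) | ⟨h, -⟩
    · exact hft (mem_roots'.1 h).2
    · exact hat (mem_roots'.1 h).2
    · exact hRt (mem_roots'.1 h).2
  -- cut counter
  set k : ℝ → ℕ := fun t => (P.filter (fun q => q < t)).card with hk
  have hk_le : ∀ t, k t ≤ P.card := fun t => Finset.card_le_card (Finset.filter_subset _ _)
  set M := g.roots.filter (fun t => 0 < t) with hM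
  have memM : ∀ t ∈ M, 0 < t ∧ g.IsRoot t := by
    intro t ht
    rw [hM, Multiset.mem_filter, mem_roots hg0] at ht
    exact ⟨ht.2, ht.1⟩
  -- (4) fibres of the cut counter have at most two roots (with multiplicity)
  have hfibre : ∀ j : ℕ, Multiset.card (M.filter (fun t => j = k t)) ≤ 2 := by
    intro j
    by_contra hcon
    push Not at hcon
    set Mj := M.filter (fun t => j = k t) with hMj
    have memMj : ∀ t ∈ Mj, (0 < t ∧ g.IsRoot t) ∧ j = k t := by
      intro t ht
      rw [hMj, Multiset.mem_filter] at ht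
      exact ⟨memM t ht.1, ht.2⟩
    have hDne : Mj.toFinset.Nonempty := by
      rw [Multiset.toFinset_nonempty, ne_eq, ← Multiset.card_eq_zero]
      omega
    set t₁ := Mj.toFinset.min' hDne with ht₁
    set t₂ := Mj.toFinset.max' hDne with ht₂
    have ht₁M : t₁ ∈ Mj := Multiset.mem_toFinset.1 (Finset.min'_mem _ hDne)
    have ht₂M : t₂ ∈ Mj := Multiset.mem_toFinset.1 (Finset.max'_mem _ hDne)
    obtain ⟨⟨ht₁pos, hgt₁⟩, hk₁⟩ := memMj t₁ ht₁M
    obtain ⟨⟨ht₂pos, hgt₂⟩, hk₂⟩ := memMj t₂ ht₂M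
    have h12 : t₁ ≤ t₂ := Finset.min'_le _ _ (Finset.max'_mem _ hDne)
    -- the arc `(L, U)` around `[t₁, t₂]`
    have hLne : ((insert (0 : ℝ) P).filter (fun q => q < t₁)).Nonempty :=
      ⟨0, Finset.mem_filter.2 ⟨Finset.mem_insert_self _ _, ht₁pos⟩⟩
    set L := ((insert (0 : ℝ) P).filter (fun q => q < t₁)).max' hLne with hL
    have hL0 : 0 ≤ L :=
      Finset.le_max' ((insert (0 : ℝ) P).filter (fun q => q < t₁)) 0
        (Finset.mem_filter.2 ⟨Finset.mem_insert_self 0 P, ht₁pos⟩)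
    have hLt₁ : L < t₁ := (Finset.mem_filter.1 (Finset.max'_mem _ hLne)).2
    set U : ℝ := if hU : (P.filter (fun q => t₂ < q)).Nonempty then (P.filter (fun q => t₂ < q)).min' hU
      else t₂ + 1 with hU
    have ht₂U : t₂ < U := by
      rw [hU]; split_ifs with h
      · exact (Finset.mem_filter.1 (Finset.min'_mem _ h)).2
      · linarith
    -- no cut point inside the arc
    have hnoP : ∀ q ∈ P, ¬ (L < q ∧ q < U) := by
      intro q hq ⟨hLq, hqU⟩
      rcases lt_or_ge q t₁ with h1 | h1
      · exact absurd (Finset.le_max' _ q (Finset.mem_filter.2 ⟨Finset.mem_insert_of_mem hq, h1⟩)) (not_le.2 hLq)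
      rcases lt_or_ge t₂ q with h2 | h2
      · have hne : (P.filter (fun q => t₂ < q)).Nonempty := ⟨q, Finset.mem_filter.2 ⟨hq, h2⟩⟩
        rw [hU, dif_pos hne] at hqU
        exact absurd (Finset.min'_le _ q (Finset.mem_filter.2 ⟨hq, h2⟩)) (not_le.2 hqU)
      -- `t₁ ≤ q ≤ t₂`: then `q` is counted by `k t₂` but not by `k t₁`, or `q = t₂`
      rcases eq_or_lt_of_le h2 with h3 | h3
      · exact havoid t₂ ht₂pos hgt₂ (h3 ▸ hq)
      · have hsub : P.filter (fun q => q < t₁) ⊆ P.filter (fun q => q < t₂) := by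
          intro x hx
          rw [Finset.mem_filter] at hx ⊢
          exact ⟨hx.1, lt_of_lt_of_le hx.2 h12⟩
        have hqin : q ∈ P.filter (fun q => q < t₂) := Finset.mem_filter.2 ⟨hq, h3⟩
        have hqout : q ∉ P.filter (fun q => q < t₁) := fun h => not_lt.2 h1 (Finset.mem_filter.1 h).2
        have hlt : (P.filter (fun q => q < t₁)).card < (P.filter (fun q => q < t₂)).card :=
          Finset.card_lt_card ⟨hsub, fun h => hqout (h hqin)⟩
        have : k t₁ < k t₂ := hlt
        omega
    -- on the arc: `f ≠ 0`, `a ≠ 0`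
    have hfarc : ∀ t, L < t → t < U → f.eval t ≠ 0 := by
      intro t h1 h2 hft
      by_cases hf0 : f = 0
      · -- `f = 0`: then `g = cX^N a` and `t₁` would be a common zero
        obtain ⟨hat, hft', -⟩ := hroot t₁ ht₁pos hgt₁
        exact hft' (by rw [hf0, eval_zero])
      refine hnoP t ?_ ⟨h1, h2⟩
      rw [hP, Finset.mem_union, Finset.mem_union]
      refine Or.inl (Or.inl ?_)
      rw [hZf, Finset.mem_filter, Multiset.mem_toFinset, mem_roots hf0]
      exact ⟨hft, hL0.trans_lt h1⟩
    have haarc : ∀ t, L < t → t < U → a.eval t ≠ 0 := by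
      intro t h1 h2 hat
      by_cases ha0 : a = 0
      · obtain ⟨hat', -⟩ := hroot t₁ ht₁pos hgt₁
        exact hat' (by rw [ha0, eval_zero])
      refine hnoP t ?_ ⟨h1, h2⟩
      rw [hP, Finset.mem_union, Finset.mem_union]
      refine Or.inl (Or.inr ?_)
      rw [hZa, Finset.mem_filter, Multiset.mem_toFinset, mem_roots ha0]
      exact ⟨hat, hL0.trans_lt h1⟩
    -- on the arc: `f·a < 0` (intermediate value theorem from `t₁`)
    have hneg : ∀ t, L < t → t < U → f.eval t * a.eval t < 0 := by
      intro t h1 h2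
      obtain ⟨-, -, hneg₁, -⟩ := hroot t₁ ht₁pos hgt₁
      by_contra hpos
      push Not at hpos
      have hpos' : 0 < f.eval t * a.eval t :=
        lt_of_le_of_ne hpos (Ne.symm (mul_ne_zero (hfarc t h1 h2) (haarc t h1 h2)))
      have hcont : Continuous fun x : ℝ => f.eval x * a.eval x := f.continuous.mul a.continuous
      -- a zero of `f·a` between `t` and `t₁`, inside the arc
      rcases lt_or_gt_of_ne (show t ≠ t₁ by rintro rfl; linarith) with hlt | hlt
      · obtain ⟨z, hz, hz0⟩ := intermediate_value_Icc' hlt.le hcont.continuousOn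
          ⟨hneg₁.le, hpos'.le⟩
        have hzarc : L < z ∧ z < U := ⟨h1.trans_le hz.1, lt_of_le_of_lt hz.2 (lt_of_le_of_lt h12 ht₂U)⟩
        rcases mul_eq_zero.1 hz0 with h | h
        · exact hfarc z hzarc.1 hzarc.2 h
        · exact haarc z hzarc.1 hzarc.2 h
      · obtain ⟨z, hz, hz0⟩ := intermediate_value_Icc hlt.le hcont.continuousOn
          ⟨hneg₁.le, hpos'.le⟩
        have hzarc : L < z ∧ z < U := ⟨hLt₁.trans_le hz.1, lt_of_le_of_lt hz.2 h2⟩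
        rcases mul_eq_zero.1 hz0 with h | h
        · exact hfarc z hzarc.1 hzarc.2 h
        · exact haarc z hzarc.1 hzarc.2 h
    -- on the arc: `R ≠ 0`
    have hRarc : ∀ t, L < t → t < U → ¬ R.IsRoot t := by
      intro t h1 h2 hRt
      by_cases hR0 : R = 0
      · -- `R = 0`: every point with `f·a < 0` is an osculation abscissa; `t₁` is one, on the line — excluded
        obtain ⟨-, -, -, hRt₁⟩ := hroot t₁ ht₁pos hgt₁
        exact hRt₁ (by rw [hR0]; exact IsRoot.def.2 (eval_zero))
      refine hnoP t ?_ ⟨h1, h2⟩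
      rw [hP, Finset.mem_union]
      refine Or.inr ?_
      rw [hT, Finset.mem_filter, Multiset.mem_toFinset, mem_roots hR0]
      exact ⟨hRt, hL0.trans_lt h1, hneg t h1 h2⟩
    -- the arc lemma
    have harc := card_roots_filter_arc_le_two f a c N hL0 hfarc haarc hRarc
    -- `Mj` sits inside the arc
    have hle : Mj ≤ g.roots.filter (fun t => L < t ∧ t < U) := by
      refine Multiset.le_filter.2 ⟨?_, ?_⟩
      · exact (Multiset.filter_le _ _).trans (Multiset.filter_le _ _)
      · intro t ht
        have ht' : t ∈ Mj.toFinset := Multiset.mem_toFinset.2 ht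
        exact ⟨hLt₁.trans_le (Finset.min'_le _ _ ht'), (Finset.le_max' _ _ ht').trans_lt ht₂U⟩
    have := Multiset.card_le_card hle
    rw [← hg] at harc
    omega
  -- (5) pigeonhole over the values of the cut counter
  have hsum : Multiset.card M = ∑ j ∈ (M.map k).toFinset, (M.map k).count j := by
    rw [Multiset.toFinset_sum_count_eq, Multiset.card_map]
  have hcount : ∀ j, (M.map k).count j ≤ 2 := by
    intro j
    rw [Multiset.count_map]
    exact hfibre j
  have hrange : (M.map k).toFinset ⊆ Finset.range (P.card + 1) := by
    intro j hj
    rw [Multiset.mem_toFinset, Multiset.mem_map] at hj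
    obtain ⟨t, -, rfl⟩ := hj
    exact Finset.mem_range.2 (Nat.lt_succ_of_le (hk_le t))
  have hM_le : Multiset.card M ≤ 2 * (P.card + 1) := by
    calc Multiset.card M = ∑ j ∈ (M.map k).toFinset, (M.map k).count j := hsum
      _ ≤ ∑ j ∈ (M.map k).toFinset, 2 := Finset.sum_le_sum fun j _ => hcount j
      _ = 2 * (M.map k).toFinset.card := by rw [Finset.sum_const, smul_eq_mul, mul_comm]
      _ ≤ 2 * (Finset.range (P.card + 1)).card := Nat.mul_le_mul_left _ (Finset.card_le_card hrange)
      _ = 2 * (P.card + 1) := by rw [Finset.card_range]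
  omega

end OsculationPeel

end Summit.ValiantsHypothesis.ValiantsHypothesis.Theorems.LacunarySymmetroidMatrixDescartes
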